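import Summits.AtomisticToContinuum.BoseEinsteinCondensation.Theorems.BECConjugateDominationTiltedCoherenceDefs
import Summits.AtomisticToContinuum.BoseEinsteinCondensation.Theorems.BECConjugateDominationInfraredMinimumUncertaintyStubCoherenceRegular
import Literature.MathematicalPhysics.QuantumManyBody.InsertionStateIdentities
import Literature.MathematicalPhysics.QuantumManyBody.PeriodicFeynmanKacFreeForm
import Mathlib.Analysis.Calculus.ParametricIntegral
import Mathlib.Analysis.SpecialFunctions.Log.Deriv
import Mathlib.MeasureTheory.Integral.IntervalIntegral.FundThmCalculus

/-!
# Route `BECConjugateDomination`, crux `InfraredMinimumUncertainty` (stmt-AtomisticToContinuum-11784),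
# line `tilted-coherence-work-variance`: the registered stub `stub_tiltedLevyIdentity` (S1)

Supports (does not close) stmt-AtomisticToContinuum-11784.  The thermodynamic-integration (Lévy)
identity of the line, KINEMATIC (no minimality), over the vocabulary of
`Theorems/BECConjugateDominationTiltedCoherenceDefs.lean` and `Theorems/BECConjugateDominationDefs.lean`:
for a pointwise non-vanishing periodic `C¹` state `Ψ` on the torus of side `L > 0`,
(a) `log g(r) = −2 ∫₀¹ min(t,1−t) Var_t(δU_r) dt`, (b) `ν_m = −2 ∫₀¹ min(t,1−t) V̂_t(m) dt`,
(c) `t ↦ V̂_t(m)` is continuous on `[0,1]`.  Since `|Ψ| > 0`, `Φ_t² = |Ψ|² e^{−2tδU_r}` is an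
exponential family in `t` with a bounded continuous exponent, so `φ_r(t) = ∫ Φ_t²` is smooth with
`(log φ_r)'' = 4 Var_t(δU_r)` (differentiation under the integral sign), `φ_r(0) = φ_r(1) = 1`,
`φ_r(½) = g(r)`; the fundamental theorem of calculus for `tψ' − ψ` on `[0,½]` and `(1−t)ψ' + ψ` on
`[½,1]` gives (a); (b) is (a) in `ν_m = L⁻³ Re ∫_cell conj(e_m) log g` after Fubini on `cell × (0,1]`;
(c) is dominated convergence.  References: C. Jarzynski, PRL 78 (1997) 2690; G. E. Crooks, PRE 60
(1999) 2721; C. Mora, Y. Castin, PRA 67 (2003) 053615 §4.3.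
-/

noncomputable section

open Literature.MathematicalPhysics.QuantumManyBody.BoseGas
open MeasureTheory Filter Set
open scoped ENNReal NNReal BigOperators ComplexConjugate Topology

namespace Summit.AtomisticToContinuum.BoseEinsteinCondensation.Theorems.BECConjugateDomination

open Summit.AtomisticToContinuum.BoseEinsteinCondensation.Cruxes.InfraredMinimumUncertainty.FisherGaussianDensityMode
open Summit.AtomisticToContinuum.BoseEinsteinCondensation.Cruxes.InfraredMinimumUncertainty.TiltedCoherenceWorkVariance
open Summit.AtomisticToContinuum.BoseEinsteinCondensation.Theorems.StaticResponseBound.Negative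
  (integral_norm_sq_eq_one)

namespace TiltedLevy

variable {n : ℕ} {L : ℝ} (hL : 0 < L) (Ψ : PeriodicTrialState (n + 1) L) (hpos : ∀ X, Ψ.ψ X ≠ 0)

/-- `τ_r (x, Y) = (x + r, Y)`. -/
theorem shiftFirst_vecCons (r x : Space) (Y : Config n) :
    shiftFirst r (Matrix.vecCons x Y) = Matrix.vecCons (x + r) Y := by
  unfold shiftFirst; rw [Matrix.cons_val_zero]; exact Fin.update_cons_zero ..

/-- `τ_r X = X + (r, 0, …, 0)`. -/
theorem shiftFirst_eq_add_single (r : Space) (X : Config (n + 1)) :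
    shiftFirst r X = X + Pi.single 0 r := by
  funext i; by_cases hi : i = 0
  · subst hi; simp [shiftFirst]
  · simp [shiftFirst, hi]

/-- `(r, X) ↦ τ_r X` is continuous. -/
theorem continuous_shiftFirst : Continuous fun q : Space × Config (n + 1) => shiftFirst q.1 q.2 := by
  unfold shiftFirst
  exact continuous_snd.update 0 (((continuous_apply 0).comp continuous_snd).add continuous_fst)

/-- `|t| ≤ |t₀| + 1` on `[t₀ − 1, t₀ + 1]`. -/
theorem abs_le_of_mem_Icc {t t₀ : ℝ} (ht : t ∈ Icc (t₀ - 1) (t₀ + 1)) : |t| ≤ |t₀| + 1 :=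
  abs_le.2 ⟨by linarith [neg_abs_le t₀, ht.1], by linarith [le_abs_self t₀, ht.2]⟩

/-- `φ_r(0) = ∫ |Ψ|² = 1` (normalisation). -/
theorem tiltNorm_zero (r : Space) : tiltNorm Ψ 0 r = 1 := by
  have : ∀ X, tiltWeight Ψ 0 r X = ‖Ψ.ψ X‖ ^ 2 := fun X => by simp [tiltWeight]
  unfold tiltNorm; simp_rw [this]; exact integral_norm_sq_eq_one Ψ

/-- `φ_r(½) = ∫ |Ψ||Ψ∘τ_r| = g(r)` (Fubini with particle `0` split off). -/
theorem tiltNorm_half (r : Space) : tiltNorm Ψ (1 / 2) r = coherence n L Ψ r := by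
  have : ∀ X, tiltWeight Ψ (1 / 2) r X = ‖Ψ.ψ X‖ * ‖Ψ.ψ (shiftFirst r X)‖ := fun X => by
    norm_num [tiltWeight]
  unfold tiltNorm coherence; simp_rw [this]
  have hc : Continuous fun X : Config (n + 1) => ‖Ψ.ψ X‖ * ‖Ψ.ψ (shiftFirst r X)‖ :=
    Ψ.contDiff.continuous.norm.mul
      (Ψ.contDiff.continuous.comp (continuous_shiftFirst.comp (Continuous.prodMk_right r))).norm
  rw [setIntegral_cellN_succ_left_of_continuous hc]
  refine integral_congr_ae (Eventually.of_forall fun x => integral_congr_ae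
    (Eventually.of_forall fun Y => ?_))
  simp only [shiftFirst_vecCons, mul_comm]

include hL in
/-- `φ_r(1) = ∫ |Ψ∘τ_r|² = 1` (shift invariance of the cell integral of the periodic `|Ψ|²`). -/
theorem tiltNorm_one (r : Space) : tiltNorm Ψ 1 r = 1 := by
  have : ∀ X, tiltWeight Ψ 1 r X = ‖Ψ.ψ (X + Pi.single 0 r)‖ ^ 2 := fun X => by
    simp [tiltWeight, shiftFirst_eq_add_single]
  unfold tiltNorm; simp_rw [this]
  rw [setIntegral_cellN_comp_add_of_periodic hL (F := fun X => ‖Ψ.ψ X‖ ^ 2)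
    (Ψ.contDiff.continuous.norm.pow 2).aestronglyMeasurable (fun X i k => by rw [Ψ.periodic])
    (Pi.single 0 r)]
  exact integral_norm_sq_eq_one Ψ

include hL in
/-- `‖r‖ ≤ 2L` on the cell. -/
theorem norm_le_of_mem_cell₁ {r : Space} (hr : r ∈ cell L) : ‖r‖ ≤ 2 * L :=
  (norm_le_pi_norm (fun _ : Fin 1 => r) 0).trans
    (norm_le_of_mem_cellN hL (show (fun _ : Fin 1 => r) ∈ cellN 1 L from fun _ => hr))

include hpos

/-- The work `(r, X) ↦ δU_r(X)` is jointly continuous (nowhere-vanishing state). -/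
theorem continuous_work : Continuous fun q : Space × Config (n + 1) => work Ψ q.1 q.2 := by
  unfold work
  exact ((Ψ.contDiff.continuous.comp continuous_snd).norm.log fun q => norm_ne_zero_iff.2 (hpos _)).sub
    ((Ψ.contDiff.continuous.comp continuous_shiftFirst).norm.log fun q => norm_ne_zero_iff.2 (hpos _))

/-- **Key simplification**: `Φ_t²(X) = |Ψ(X)|^{2(1−t)} |Ψ(τ_r X)|^{2t} = |Ψ(X)|² e^{−2t δU_r(X)}`, an
exponential family in `t`. -/
theorem tiltWeight_eq_exp (t : ℝ) (r : Space) (X : Config (n + 1)) :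
    tiltWeight Ψ t r X = ‖Ψ.ψ X‖ ^ 2 * Real.exp (t * (-2 * work Ψ r X)) := by
  have ha : 0 < ‖Ψ.ψ X‖ := norm_pos_iff.2 (hpos X)
  unfold tiltWeight work
  rw [Real.rpow_def_of_pos ha, Real.rpow_def_of_pos (norm_pos_iff.2 (hpos _)), ← Real.exp_add,
    ← Real.exp_log (pow_pos ha 2), Real.log_pow, ← Real.exp_add]
  congr 1; push_cast; ring

/-- `X ↦ δU_r(X)` is continuous. -/
theorem continuous_work_right (r : Space) : Continuous fun X : Config (n + 1) => work Ψ r X :=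
  (continuous_work Ψ hpos).comp (Continuous.prodMk_right r)

/-- `X ↦ Φ_t²(X) δU_r(X)^k` is continuous. -/
theorem continuous_integrand (k : ℕ) (t : ℝ) (r : Space) :
    Continuous fun X : Config (n + 1) => tiltWeight Ψ t r X * work Ψ r X ^ k := by
  simp only [tiltWeight_eq_exp Ψ hpos]
  exact ((Ψ.contDiff.continuous.norm.pow 2).mul (Real.continuous_exp.comp (continuous_const.mul
    (continuous_const.mul (continuous_work_right Ψ hpos r))))).mul
      ((continuous_work_right Ψ hpos r).pow k)

/-- Expansion of the centred square:
`Var_t = φ⁻¹ (∫ Φ_t² δU² − 2 E_t[δU] ∫ Φ_t² δU + E_t[δU]² φ)`. -/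
theorem tiltVar_eq (t : ℝ) (r : Space) : tiltVar Ψ t r = (tiltNorm Ψ t r)⁻¹ *
    ((∫ X in cellN (n + 1) L, tiltWeight Ψ t r X * work Ψ r X ^ 2) -
      2 * tiltMean Ψ t r * (∫ X in cellN (n + 1) L, tiltWeight Ψ t r X * work Ψ r X) +
      tiltMean Ψ t r ^ 2 * tiltNorm Ψ t r) := by
  have hI : ∀ k : ℕ, Integrable (fun X => tiltWeight Ψ t r X * work Ψ r X ^ k)
      (volume.restrict (cellN (n + 1) L)) := fun k =>
    integrableOn_cellN (continuous_integrand Ψ hpos k t r) L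
  have i0 := hI 0
  have i1 := hI 1
  simp only [pow_zero, mul_one, pow_one] at i0 i1
  unfold tiltVar
  congr 1
  have hexp : ∀ X, tiltWeight Ψ t r X * (work Ψ r X - tiltMean Ψ t r) ^ 2 =
      tiltWeight Ψ t r X * work Ψ r X ^ 2 - 2 * tiltMean Ψ t r * (tiltWeight Ψ t r X * work Ψ r X) +
        tiltMean Ψ t r ^ 2 * tiltWeight Ψ t r X := fun X => by ring
  simp_rw [hexp]
  rw [integral_add _ (i0.const_mul _), integral_sub (hI 2) (i1.const_mul _), integral_const_mul,
    integral_const_mul]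
  · rfl
  · exact (hI 2).sub (i1.const_mul _)

include hL

/-- The work is bounded, `|δU_r(X)| ≤ K` uniformly (`0 < inf |Ψ| ≤ |Ψ| ≤ sup |Ψ|`). -/
theorem exists_abs_work_le : ∃ K : ℝ, ∀ r X, |work Ψ r X| ≤ K := by
  obtain ⟨M, hM⟩ := Ψ.exists_norm_le hL
  obtain ⟨m, hm, hmle⟩ := exists_pos_forall_le_norm hL Ψ hpos
  have hlog : ∀ X, Real.log m ≤ Real.log ‖Ψ.ψ X‖ ∧ Real.log ‖Ψ.ψ X‖ ≤ Real.log M := fun X =>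
    ⟨Real.log_le_log hm (hmle X), Real.log_le_log (norm_pos_iff.2 (hpos X)) (hM X)⟩
  refine ⟨Real.log M - Real.log m, fun r X => ?_⟩
  unfold work
  rw [abs_sub_le_iff]
  exact ⟨by linarith [(hlog X).2, (hlog (shiftFirst r X)).1],
    by linarith [(hlog X).1, (hlog (shiftFirst r X)).2]⟩

/-- Uniform bound of the integrands `Φ_t² δU_r^k` for `|t| ≤ T`. -/
theorem exists_bound_integrand (k : ℕ) (T : ℝ) :
    ∃ C : ℝ, ∀ t r X, |t| ≤ T → ‖tiltWeight Ψ t r X * work Ψ r X ^ k‖ ≤ C := by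
  obtain ⟨M, hM⟩ := Ψ.exists_norm_le hL
  obtain ⟨K, hK⟩ := exists_abs_work_le hL Ψ hpos
  refine ⟨M ^ 2 * Real.exp (T * (2 * K)) * K ^ k, fun t r X ht => ?_⟩
  rw [tiltWeight_eq_exp Ψ hpos, Real.norm_eq_abs, abs_mul, abs_mul, abs_pow, abs_pow, abs_norm,
    Real.abs_exp]
  have h2 : Real.exp (t * (-2 * work Ψ r X)) ≤ Real.exp (T * (2 * K)) := by
    refine Real.exp_le_exp.2 ((le_abs_self _).trans ?_)
    rw [abs_mul, abs_mul, abs_neg, abs_two]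
    exact mul_le_mul ht (by linarith [hK r X]) (by positivity) ((abs_nonneg t).trans ht)
  exact mul_le_mul (mul_le_mul (pow_le_pow_left₀ (norm_nonneg _) (hM X) 2) h2 (by positivity)
    (by positivity)) (pow_le_pow_left₀ (abs_nonneg _) (hK r X) k) (by positivity) (by positivity)

/-- Joint continuity in `(t, r)` of the tilted moments `∫ Φ_t² δU_r^k` (dominated convergence on the
finite-measure cell with a locally uniform constant bound). -/
theorem continuous_tiltMoment (k : ℕ) : Continuous fun p : ℝ × Space =>
    ∫ X in cellN (n + 1) L, tiltWeight Ψ p.1 p.2 X * work Ψ p.2 X ^ k := by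
  have hw : Continuous fun z : (ℝ × Space) × Config (n + 1) => work Ψ z.1.2 z.2 :=
    (continuous_work Ψ hpos).comp ((continuous_snd.comp continuous_fst).prodMk continuous_snd)
  have hF : Continuous fun z : (ℝ × Space) × Config (n + 1) =>
      tiltWeight Ψ z.1.1 z.1.2 z.2 * work Ψ z.1.2 z.2 ^ k := by
    simp only [tiltWeight_eq_exp Ψ hpos]
    exact (((Ψ.contDiff.continuous.comp continuous_snd).norm.pow 2).mul (Real.continuous_exp.comp
      (continuous_fst.fst.mul (continuous_const.mul hw)))).mul (hw.pow k)
  refine continuous_iff_continuousAt.2 fun p₀ => ?_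
  obtain ⟨C, hC⟩ := exists_bound_integrand hL Ψ hpos k (|p₀.1| + 1)
  refine continuousAt_of_dominated (bound := fun _ => C)
    (Eventually.of_forall fun p => (hF.comp (Continuous.prodMk_right p)).aestronglyMeasurable) ?_
    (integrableOn_const (volume_cellN_ne_top _ _))
    (Eventually.of_forall fun X => (hF.comp (Continuous.prodMk_left X)).continuousAt)
  filter_upwards [continuous_fst.continuousAt.preimage_mem_nhds
    (Icc_mem_nhds (sub_one_lt p₀.1) (lt_add_one p₀.1))] with p hp
  exact Eventually.of_forall fun X => hC _ _ X (abs_le_of_mem_Icc hp)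

/-- `d/dt ∫ Φ_t² δU_r^k = −2 ∫ Φ_t² δU_r^{k+1}` (differentiation under the integral sign). -/
theorem hasDerivAt_tiltMoment (k : ℕ) (r : Space) (t₀ : ℝ) :
    HasDerivAt (fun t : ℝ => ∫ X in cellN (n + 1) L, tiltWeight Ψ t r X * work Ψ r X ^ k)
      (-2 * ∫ X in cellN (n + 1) L, tiltWeight Ψ t₀ r X * work Ψ r X ^ (k + 1)) t₀ := by
  obtain ⟨C, hC⟩ := exists_bound_integrand hL Ψ hpos (k + 1) (|t₀| + 1)
  have hc := continuous_integrand Ψ hpos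
  rw [← integral_const_mul]
  refine (hasDerivAt_integral_of_dominated_loc_of_deriv_le
    (F := fun t X => tiltWeight Ψ t r X * work Ψ r X ^ k)
    (F' := fun t X => -2 * (tiltWeight Ψ t r X * work Ψ r X ^ (k + 1))) (bound := fun _ => 2 * C)
    (Icc_mem_nhds (sub_one_lt t₀) (lt_add_one t₀))
    (Eventually.of_forall fun t => (hc k t r).aestronglyMeasurable) (integrableOn_cellN (hc k t₀ r) L)
    (continuous_const.mul (hc (k + 1) t₀ r)).aestronglyMeasurable
    (Eventually.of_forall fun X t ht => ?_) (integrableOn_const (volume_cellN_ne_top _ _))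
    (Eventually.of_forall fun X t _ => ?_)).2
  · rw [norm_mul, show ‖(-2 : ℝ)‖ = 2 by norm_num]
    exact mul_le_mul_of_nonneg_left (hC t r X (abs_le_of_mem_Icc ht)) zero_le_two
  · simp only [tiltWeight_eq_exp Ψ hpos]
    exact ((((hasDerivAt_id' t).mul_const (-2 * work Ψ r X)).exp.const_mul (‖Ψ.ψ X‖ ^ 2)).mul_const
      (work Ψ r X ^ k)).congr_deriv (by ring)

/-- `φ_r(t) > 0` (a positive continuous integrand on the positive-measure cell). -/
theorem tiltNorm_pos (t : ℝ) (r : Space) : 0 < tiltNorm Ψ t r := by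
  have hw : ∀ X, 0 < tiltWeight Ψ t r X := fun X => by
    rw [tiltWeight_eq_exp Ψ hpos]
    exact mul_pos (pow_pos (norm_pos_iff.2 (hpos X)) 2) (Real.exp_pos _)
  have hc := continuous_integrand Ψ hpos 0 t r
  simp only [pow_zero, mul_one] at hc
  unfold tiltNorm
  rw [integral_pos_iff_support_of_nonneg_ae (Eventually.of_forall fun X => (hw X).le)
    (integrableOn_cellN hc L), Set.eq_univ_of_forall fun X => Function.mem_support.2 (hw X).ne',
    Measure.restrict_apply_univ]
  exact pos_iff_ne_zero.2 (volume_cellN_ne_zero _ hL)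

/-- Joint continuity of `(t, r) ↦ Var_t(δU_r)`. -/
theorem continuous_tiltVar : Continuous fun p : ℝ × Space => tiltVar Ψ p.1 p.2 := by
  have h0 := continuous_tiltMoment hL Ψ hpos 0
  have h1 := continuous_tiltMoment hL Ψ hpos 1
  simp only [pow_zero, mul_one, pow_one] at h0 h1
  have hA : Continuous fun p : ℝ × Space => tiltNorm Ψ p.1 p.2 := h0
  have hne : ∀ p : ℝ × Space, tiltNorm Ψ p.1 p.2 ≠ 0 := fun p => (tiltNorm_pos hL Ψ hpos _ _).ne'
  have hM : Continuous fun p : ℝ × Space => tiltMean Ψ p.1 p.2 := (hA.inv₀ hne).mul h1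
  simp only [tiltVar_eq Ψ hpos]
  exact (hA.inv₀ hne).mul (((continuous_tiltMoment hL Ψ hpos 2).sub
    ((continuous_const.mul hM).mul h1)).add ((hM.pow 2).mul hA))

/-- **(a)** `log g(r) = −2 ∫₀¹ min(t, 1−t) Var_t(δU_r) dt`: `ψ_r = log φ_r` has `ψ_r' = −2 E_t[δU_r]`,
`ψ_r'' = 4 Var_t(δU_r)`, `ψ_r(0) = ψ_r(1) = 0`, `ψ_r(½) = log g(r)`; then the fundamental theorem of
calculus for `t ψ_r' − ψ_r` on `[0, ½]` and `(1 − t) ψ_r' + ψ_r` on `[½, 1]`. -/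
theorem log_coherence_eq (r : Space) :
    Real.log (coherence n L Ψ r) = -2 * ∫ t in (0 : ℝ)..1, min t (1 - t) * tiltVar Ψ t r := by
  have hA0 : ∀ t, tiltNorm Ψ t r ≠ 0 := fun t => (tiltNorm_pos hL Ψ hpos t r).ne'
  have hAd : ∀ t, HasDerivAt (fun t => tiltNorm Ψ t r)
      (-2 * ∫ X in cellN (n + 1) L, tiltWeight Ψ t r X * work Ψ r X) t := fun t => by
    have h := hasDerivAt_tiltMoment hL Ψ hpos 0 r t
    simp only [pow_zero, mul_one, zero_add, pow_one] at h
    exact h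
  have hBd : ∀ t, HasDerivAt (fun t => ∫ X in cellN (n + 1) L, tiltWeight Ψ t r X * work Ψ r X)
      (-2 * ∫ X in cellN (n + 1) L, tiltWeight Ψ t r X * work Ψ r X ^ 2) t := fun t => by
    have h := hasDerivAt_tiltMoment hL Ψ hpos 1 r t
    simp only [pow_one, Nat.reduceAdd] at h
    exact h
  have hψ : ∀ t, HasDerivAt (fun t => Real.log (tiltNorm Ψ t r))
      ((-2 * ∫ X in cellN (n + 1) L, tiltWeight Ψ t r X * work Ψ r X) / tiltNorm Ψ t r) t :=
    fun t => (hAd t).log (hA0 t)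
  have hD : ∀ t, HasDerivAt (fun t => (-2 * ∫ X in cellN (n + 1) L,
      tiltWeight Ψ t r X * work Ψ r X) / tiltNorm Ψ t r) (4 * tiltVar Ψ t r) t := fun t => by
    refine (((hBd t).const_mul (-2)).div (hAd t) (hA0 t)).congr_deriv ?_
    have := hA0 t
    rw [tiltVar_eq Ψ hpos]; unfold tiltMean; field_simp; ring
  have hm4 : Continuous fun t : ℝ => 4 * (min t (1 - t) * tiltVar Ψ t r) :=
    continuous_const.mul ((continuous_id.min (continuous_const.sub continuous_id)).mul
      ((continuous_tiltVar hL Ψ hpos).comp (Continuous.prodMk_left r)))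
  -- FTC on the two halves
  have i1 := intervalIntegral.integral_eq_sub_of_hasDerivAt (a := 0) (b := 1 / 2) (fun t ht => by
      rw [uIcc_of_le (by norm_num)] at ht
      simp only [min_eq_left (by linarith [ht.2] : t ≤ 1 - t)]
      exact (((hasDerivAt_id' t).mul (hD t)).sub (hψ t)).congr_deriv (by ring))
    (hm4.intervalIntegrable _ _)
  have i2 := intervalIntegral.integral_eq_sub_of_hasDerivAt (a := 1 / 2) (b := 1) (fun t ht => by
      rw [uIcc_of_le (by norm_num)] at ht
      simp only [min_eq_right (by linarith [ht.1] : 1 - t ≤ t)]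
      exact ((((hasDerivAt_id' t).const_sub (1 : ℝ)).mul (hD t)).add (hψ t)).congr_deriv (by ring))
    (hm4.intervalIntegrable _ _)
  have hs := intervalIntegral.integral_add_adjacent_intervals (μ := volume)
    (hm4.intervalIntegrable 0 (1 / 2)) (hm4.intervalIntegrable (1 / 2) 1)
  have j : ∫ t in (0 : ℝ)..1, 4 * (min t (1 - t) * tiltVar Ψ t r) =
      4 * ∫ t in (0 : ℝ)..1, min t (1 - t) * tiltVar Ψ t r := intervalIntegral.integral_const_mul _ _
  simp only [Pi.mul_apply, Pi.sub_apply, Pi.add_apply] at i1 i2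
  have v0 : Real.log (tiltNorm Ψ 0 r) = 0 := by rw [tiltNorm_zero, Real.log_one]
  have v1 : Real.log (tiltNorm Ψ 1 r) = 0 := by rw [tiltNorm_one hL, Real.log_one]
  rw [← tiltNorm_half Ψ r]
  linarith [i1, i2, hs, j, v0, v1]

/-- **(b)** `ν_m = −2 ∫₀¹ min(t,1−t) V̂_t(m) dt` (insert (a) in `ν_m = L⁻³ Re ∫_cell conj(e_m) log g`,
Fubini on `cell × (0,1]` for the bounded continuous integrand, linearity of `Re`). -/
theorem levyWeight_eq (m : Fin 3 → ℤ) :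
    levyWeight n L Ψ m = -2 * ∫ t in (0 : ℝ)..1, min t (1 - t) * tiltVarCoeff n L Ψ t m := by
  have hV := continuous_tiltVar hL Ψ hpos
  unfold levyWeight tiltVarCoeff
  simp_rw [cellFourierCoeff_eq_integral hL, Complex.smul_re, smul_eq_mul, log_coherence_eq hL Ψ hpos]
  have step1 : ∀ r : Space, conj (cellWave L m r) *
      (((-2 * ∫ t in (0 : ℝ)..1, min t (1 - t) * tiltVar Ψ t r : ℝ)) : ℂ) =
      ∫ t in (0 : ℝ)..1, conj (cellWave L m r) *
        (((-2 * (min t (1 - t) * tiltVar Ψ t r) : ℝ)) : ℂ) := fun r => by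
    rw [← intervalIntegral.integral_const_mul, ← intervalIntegral.integral_ofReal,
      ← intervalIntegral.integral_const_mul]
  simp_rw [step1, intervalIntegral.integral_of_le (zero_le_one' ℝ)]
  -- Fubini on `cell × (0, 1]`
  have hF : Continuous (Function.uncurry fun (r : Space) (t : ℝ) =>
      conj (cellWave L m r) * (((-2 * (min t (1 - t) * tiltVar Ψ t r) : ℝ)) : ℂ)) :=
    (Complex.continuous_conj.comp ((continuous_cellWave L m).comp continuous_fst)).mul
      (Complex.continuous_ofReal.comp (continuous_const.mul
        ((continuous_snd.min (continuous_const.sub continuous_snd)).mul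
          (hV.comp (continuous_snd.prodMk continuous_fst)))))
  have hint : Integrable (Function.uncurry fun (r : Space) (t : ℝ) =>
      conj (cellWave L m r) * (((-2 * (min t (1 - t) * tiltVar Ψ t r) : ℝ)) : ℂ))
      ((volume.restrict (cell L)).prod (volume.restrict (Ioc (0 : ℝ) 1))) := by
    rw [Measure.prod_restrict]
    exact (hF.continuousOn.integrableOn_compact
      ((isCompact_closedBall (0 : Space) (2 * L)).prod isCompact_Icc)).mono_set
      (Set.prod_mono (fun r hr => Metric.mem_closedBall.2
        (by rw [dist_zero_right]; exact norm_le_of_mem_cell₁ hL hr)) Ioc_subset_Icc_self)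
  rw [integral_integral_swap hint]
  -- real part through the `t`-integral, scalars out of the `r`-integral
  have step4 := integral_re hint.integral_prod_right
  simp only [Function.uncurry_apply_pair, RCLike.re_to_complex] at step4
  rw [← step4, ← integral_const_mul, ← integral_const_mul]
  refine integral_congr_ae (Eventually.of_forall fun t => ?_)
  have step3 : (∫ r in cell L, conj (cellWave L m r) *
      (((-2 * (min t (1 - t) * tiltVar Ψ t r) : ℝ)) : ℂ)) = (((-2 * min t (1 - t) : ℝ)) : ℂ) *
        ∫ r in cell L, conj (cellWave L m r) * (tiltVar Ψ t r : ℂ) := by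
    rw [← integral_const_mul]
    exact integral_congr_ae (Eventually.of_forall fun r => by push_cast; ring)
  simp only [step3, Complex.re_ofReal_mul]
  ring

/-- **(c)** `t ↦ V̂_t(m) = L⁻³ Re ∫_cell conj(e_m) Var_t` is continuous on `[0, 1]` (indeed on `ℝ`:
dominated convergence on the cell, bound from compactness of `[t₀−1, t₀+1] × B̄(0, 2L)`). -/
theorem continuousOn_tiltVarCoeff (m : Fin 3 → ℤ) :
    ContinuousOn (fun t : ℝ => tiltVarCoeff n L Ψ t m) (Icc 0 1) := by
  have hV := continuous_tiltVar hL Ψ hpos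
  have hF : Continuous fun z : ℝ × Space => conj (cellWave L m z.2) * (tiltVar Ψ z.1 z.2 : ℂ) :=
    (Complex.continuous_conj.comp ((continuous_cellWave L m).comp continuous_snd)).mul
      (Complex.continuous_ofReal.comp hV)
  have hJ : Continuous fun t : ℝ => ∫ r in cell L, conj (cellWave L m r) * (tiltVar Ψ t r : ℂ) := by
    refine continuous_iff_continuousAt.2 fun t₀ => ?_
    obtain ⟨C, hC⟩ := (isCompact_Icc.prod (isCompact_closedBall (0 : Space) (2 * L)))
      |>.exists_bound_of_continuousOn (f := fun p : ℝ × Space => tiltVar Ψ p.1 p.2)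
        (s := Icc (t₀ - 1) (t₀ + 1) ×ˢ Metric.closedBall (0 : Space) (2 * L)) hV.continuousOn
    refine continuousAt_of_dominated (bound := fun _ => C)
      (Eventually.of_forall fun t => (hF.comp (Continuous.prodMk_right t)).aestronglyMeasurable) ?_
      (integrableOn_const (by rw [volume_cell]; exact ENNReal.pow_ne_top ENNReal.ofReal_ne_top))
      (Eventually.of_forall fun r => (hF.comp (Continuous.prodMk_left r)).continuousAt)
    filter_upwards [Icc_mem_nhds (sub_one_lt t₀) (lt_add_one t₀)] with t ht
    refine ae_restrict_of_forall_mem (measurableSet_cell L) fun r hr => ?_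
    rw [norm_mul, Complex.norm_conj, norm_cellWave, one_mul, Complex.norm_real]
    exact hC (t, r) ⟨ht, Metric.mem_closedBall.2
      (by rw [dist_zero_right]; exact norm_le_of_mem_cell₁ hL hr)⟩
  have hcoef : (fun t : ℝ => tiltVarCoeff n L Ψ t m) = fun t =>
      (L ^ 3)⁻¹ * (∫ r in cell L, conj (cellWave L m r) * (tiltVar Ψ t r : ℂ)).re := by
    funext t; unfold tiltVarCoeff; rw [cellFourierCoeff_eq_integral hL, Complex.smul_re, smul_eq_mul]
  rw [hcoef]
  exact (continuous_const.mul (Complex.continuous_re.comp hJ)).continuousOn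

end TiltedLevy

/-! ## The registered stub -/

open TiltedLevy in
/-- **S1 `stub_tiltedLevyIdentity`** (registered signature, verbatim; KINEMATIC — no minimality): for
a pointwise non-vanishing periodic `C¹` state `Ψ` of `n + 1` bosons on the torus of side `L > 0`,
(a) `log g(r) = −2 ∫₀¹ min(t,1−t) Var_{μ_t}(δU_r) dt` for every `r`; for every mode `m`,
(b) `ν_m = −2 ∫₀¹ min(t,1−t) V̂_t(m) dt` and (c) `t ↦ V̂_t(m)` is continuous on `[0,1]`. -/
theorem stub_tiltedLevyIdentity :
    ∀ (n : ℕ) (L : ℝ), 0 < L → ∀ Ψ : PeriodicTrialState (n + 1) L, (∀ X, Ψ.ψ X ≠ 0) →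
      (∀ r : Space,
          Real.log (coherence n L Ψ r) = -2 * ∫ t in (0 : ℝ)..1, min t (1 - t) * tiltVar Ψ t r) ∧
        ∀ m : Fin 3 → ℤ,
          levyWeight n L Ψ m = -2 * ∫ t in (0 : ℝ)..1, min t (1 - t) * tiltVarCoeff n L Ψ t m ∧
            ContinuousOn (fun t : ℝ => tiltVarCoeff n L Ψ t m) (Set.Icc 0 1) := by
  intro n L hL Ψ hpos
  exact ⟨log_coherence_eq hL Ψ hpos, fun m =>
    ⟨levyWeight_eq hL Ψ hpos m, continuousOn_tiltVarCoeff hL Ψ hpos m⟩⟩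

end Summit.AtomisticToContinuum.BoseEinsteinCondensation.Theorems.BECConjugateDomination

end
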